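import Summits.QuantumFields.YangMills.Theorems.UnitScaleTiltProp7FlatFaberKrahnZd
import Summits.QuantumFields.YangMills.Theorems.UnitScaleTiltProp7FlatLevelIteration
import HarnessLib

/-!
# Route R of crux K1 «MinimiserStabilityRegPr» (stmt-QuantumFields-19200) — THE `L^∞` BOUND FOR THE BOX DIRICHLET CORRECTOR WITH
# DIVERGENCE-FORM DATA ON `ℤ^d`: `−Δw = ∂*g` on `Q_r(z)`, `w = 0` outside, `|g| ≤ m` ⟹ `|w| ≤ 64·2^d·d·m·(2r+1)` — De Giorgi ∕ Stampacchia
# truncation in Faber–Krahn form, with NO fractional powers (brick 2b of the flat linear interior-regularity core; cell `ym3-torus`,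
# width seat `ym-ust-19200-w1` g6; OWNER ACK 22 (a); `--supports stmt-QuantumFields-19200 --as helper`, count-neutral)

YM₃ on T³ is a RUNG of the ladder (R3), not the Clay problem; nothing here claims the stub, the crux or the gap.

WHY.  The sourced interior mean-value estimate at the scaling route R's nonlinear passage needs (CARD-19200-V3-g11 §6 (S3)∕(S3′); the displayed
`C_reg` input of `Prop7FibreQDefect(Ell2)`) is `u(x)² ≲ ℓ^{−d}Σ_{Q}u² + ℓ²‖g‖²_∞` for `−Δu = ∂*g`; after harmonic replacement `u = h + w` on the box
(`B4Eq19LatticeDirichletZero.exists_harmonic_replacement_zero`) and brick 1 for `h`, everything rests on the sup bound for the corrector `w` at the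
OPTIMAL scaling `r·‖g‖_∞` (the energy∕line-sum bound `r^{(d+1)/2}‖g‖_∞` is useless).  This file proves it by level truncation: the energy of `(w−k)₊` is
paid by the measure of the super-level set (test the equation with `(w−k)₊`), the Faber–Krahn inequality of brick 2a converts small support into a
spectral gain, and a dyadic iteration over the levels `D(1 − 2^{−n})` with INTEGER tile sides `4⌈(2r+1)/2ⁿ⌉` terminates because cardinalities below
`1` vanish.

WHAT IS PROVED (sorry-free, no definition; `ℤ^d` letters of `B4Eq19LatticeOperators`).
* §1 pointwise: `trunc_sq_le_mul` (`((a−k)₊ − (b−k)₊)² ≤ ((a−k)₊ − (b−k)₊)(a − b)`), `mul_le_half_sq_add` (`t·γ ≤ ½t² + ½m²·[t ≠ 0]` for `|γ| ≤ m`).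
* §2 `truncation_energy_le` — for `w = 0` off `Q_r(z)`, `−Δw = ∂*g` on `Q_r(z)`, `|g| ≤ m` on `Q_{r+1}(z)`, `k ≥ 0`:
  `Σ_{Q_{r+1}(z)} |∇(w−k)₊|² ≤ 2d·m²·#{y ∈ Q_r(z) : w(y) > k}`.
* §3 `deGiorgi_step` — with a tile side `ρ ≥ 1`, `4·#{w > k} ≤ ρ^d`, and `h > k ≥ 0`: `(h−k)²·#{w > h} ≤ 8d²m²ρ²·#{w > k}` (brick 2a `faberKrahn`).
* (the real-variable iteration `levels_vanish` — levels `D(1−2^{−n})`, integer tile sides `4⌈M∕2ⁿ⌉`, termination via `Nat.log` — is the sibling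
  file `Prop7FlatLevelIteration`, `import Mathlib` only.)
* §4 `le_of_dirichlet`, ★★ `abs_le_of_dirichlet` — `|w(y)| ≤ 64·2^d·d·m·(2r+1)` for every `y` (both signs; `m ≥ 0`, `d ≥ 1`, `r ≥ 0`).

HONEST SCOPE.  [folklore] lattice analysis (De Giorgi 1957 ∕ Stampacchia's truncation, in Grigor'yan's Faber–Krahn form; [Giaquinta1984] Ch. III as method
pointer); flat, scalar, linear; constants crude.  Brick 2c (the assembled sourced mean-value inequality for scalars and 1-forms + torus pullback) is the next
file.  Nothing of Bałaban's is asserted.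

References: M. Giaquinta, *Multiple integrals in the calculus of variations and nonlinear elliptic systems*, Princeton UP 1983 [Giaquinta1984] (Ch. III §2);
T. Bałaban, CMP 96 (1984) 223–250 [Balaban1984PropagatorsII] ((1.9) p.226).
-/

set_option autoImplicit false

noncomputable section

open scoped BigOperators
open Finset

namespace Summit.QuantumFields.YangMills.Theorems.Prop7FlatDirichletSup

open Literature.MathematicalPhysics.QuantumFieldTheory.Balaban1983to89
open B4Eq19LatticeOperators
open Summit.QuantumFields.YangMills.Theorems.Prop7FlatFaberKrahnZd (faberKrahn)
open Summit.QuantumFields.YangMills.Theorems.Prop7FlatLevelIteration (levels_vanish)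

variable {d : ℕ}

/-! ## §1 Pointwise inequalities -/

/-- The truncation `t ↦ (t − k)₊` is monotone and `1`-Lipschitz: `((a−k)₊ − (b−k)₊)² ≤ ((a−k)₊ − (b−k)₊)·(a − b)`. [folklore] -/
theorem trunc_sq_le_mul (a b k : ℝ) :
    (max (a - k) 0 - max (b - k) 0) ^ 2 ≤ (max (a - k) 0 - max (b - k) 0) * (a - b) := by
  rcases le_total (a - k) 0 with ha | ha <;> rcases le_total (b - k) 0 with hb | hb
  · rw [max_eq_right ha, max_eq_right hb]; simp
  · rw [max_eq_right ha, max_eq_left hb]; nlinarith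
  · rw [max_eq_left ha, max_eq_right hb]; nlinarith
  · rw [max_eq_left ha, max_eq_left hb]; nlinarith

/-- `t·γ ≤ ½t² + ½m²·[t ≠ 0]` for `|γ| ≤ m` (Young's inequality, with the indicator recording where the test gradient lives). [folklore] -/
theorem mul_le_half_sq_add (t γ m : ℝ) (hγ : |γ| ≤ m) :
    t * γ ≤ (1 / 2) * t ^ 2 + (1 / 2) * m ^ 2 * (if t ≠ 0 then 1 else 0) := by
  by_cases ht : t = 0
  · simp [ht]
  · rw [if_pos ht, mul_one]
    have h1 : t * γ ≤ |t| * m := by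
      calc t * γ ≤ |t * γ| := le_abs_self _
        _ = |t| * |γ| := abs_mul t γ
        _ ≤ |t| * m := mul_le_mul_of_nonneg_left hγ (abs_nonneg t)
    have h2 : |t| * m ≤ (1 / 2) * t ^ 2 + (1 / 2) * m ^ 2 := by
      have := sq_abs t
      nlinarith [sq_nonneg (|t| - m)]
    linarith

/-! ## §2 The energy of a truncation is paid by the measure of the super-level set -/

/-- **Caccioppoli-on-level-sets for the Dirichlet corrector.**  `w = 0` off `Q_r(z)`, `−Δw = ∂*g` on `Q_r(z)`, `|g(y,μ)| ≤ m` for `y ∈ Q_{r+1}(z)`,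
`k ≥ 0`; then the lattice energy of `(w − k)₊` over `Q_{r+1}(z)` is at most `2d·m²·#{y ∈ Q_r(z) : k < w(y)}` (test the equation with `(w−k)₊`:
`Σ∇(w−k)₊·∇w = Σ∇(w−k)₊·g`, monotone truncation on the left, Young on the right, and every bond carrying a nonzero `∇(w−k)₊` has an end in the
super-level set). [folklore] [cite: Giaquinta1984, Ch. III §2 (2.3) p.77] -/
theorem truncation_energy_le {w : Zd d → ℝ} {z : Zd d} {r : ℤ} (g : Zd d → Fin d → ℝ) {m k : ℝ} (hk : 0 ≤ k)
    (hw0 : ∀ y ∉ box z r, w y = 0) (hw : ∀ y ∈ box z r, lop 0 w y = dvg g y)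
    (hg : ∀ y ∈ box z (r + 1), ∀ μ, |g y μ| ≤ m) :
    ∑ y ∈ box z (r + 1), ∑ μ, fdiff μ (fun x => max (w x - k) 0) y ^ 2 ≤
      2 * d * m ^ 2 * (((box z r).filter fun y => k < w y).card : ℝ) := by
  classical
  set φ : Zd d → ℝ := fun x => max (w x - k) 0 with hφ
  set A := (box z r).filter fun y => k < w y with hA
  have hφ0 : ∀ y ∉ box z r, φ y = 0 := fun y hy => by
    simp only [hφ, hw0 y hy, zero_sub, max_eq_right (neg_nonpos.mpr hk)]
  have hφ0' : ∀ y ∉ box z (r + 1 - 1), φ y = 0 := fun y hy => hφ0 y (by simpa using hy)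
  -- where `φ ≠ 0`
  have hφA : ∀ y, φ y ≠ 0 → y ∈ A := by
    intro y hy
    have hyb : y ∈ box z r := by
      by_contra h
      exact hy (hφ0 y h)
    rw [hA, Finset.mem_filter]
    refine ⟨hyb, ?_⟩
    by_contra hle
    push Not at hle
    exact hy (by simp only [hφ]; exact max_eq_right (by linarith))
  set E := ∑ y ∈ box z (r + 1), ∑ μ, fdiff μ φ y ^ 2 with hE
  -- (1) monotone truncation: `E ≤ Σ ∇φ·∇w`
  have h1 : E ≤ ∑ y ∈ box z (r + 1), ∑ μ, fdiff μ φ y * fdiff μ w y := by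
    refine Finset.sum_le_sum fun y _ => Finset.sum_le_sum fun μ _ => ?_
    simp only [fdiff_apply, hφ]
    exact trunc_sq_le_mul _ _ _
  -- (2) the Dirichlet form is `Σ φ·(−Δw)`
  have h2 : ∑ y ∈ box z (r + 1), ∑ μ, fdiff μ φ y * fdiff μ w y = ∑ y ∈ box z (r + 1), φ y * lop 0 w y := by
    rw [sum_mul_lop 0 φ w z (r + 1) hφ0', zero_mul, add_zero]
  -- (3) the equation, where `φ` lives
  have h3 : ∑ y ∈ box z (r + 1), φ y * lop 0 w y = ∑ y ∈ box z (r + 1), φ y * dvg g y := by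
    refine Finset.sum_congr rfl fun y _ => ?_
    by_cases hy : y ∈ box z r
    · rw [hw y hy]
    · rw [hφ0 y hy, zero_mul, zero_mul]
  -- (4) summation by parts for the divergence
  have h4 : ∑ y ∈ box z (r + 1), φ y * dvg g y = ∑ y ∈ box z (r + 1), ∑ μ, fdiff μ φ y * g y μ :=
    sum_mul_dvg φ g z (r + 1) hφ0'
  -- (5) Young, bond by bond
  have h5 : ∑ y ∈ box z (r + 1), ∑ μ, fdiff μ φ y * g y μ ≤
      (1 / 2) * E + (1 / 2) * m ^ 2 * ∑ y ∈ box z (r + 1), ∑ μ : Fin d, (if fdiff μ φ y ≠ 0 then (1 : ℝ) else 0) := by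
    rw [hE, Finset.mul_sum, Finset.mul_sum, ← Finset.sum_add_distrib]
    refine Finset.sum_le_sum fun y hy => ?_
    rw [Finset.mul_sum, Finset.mul_sum, ← Finset.sum_add_distrib]
    exact Finset.sum_le_sum fun μ _ => mul_le_half_sq_add _ _ _ (hg y hy μ)
  -- (6) counting the bonds: each carries an end in `A`
  have h6 : ∑ y ∈ box z (r + 1), ∑ μ : Fin d, (if fdiff μ φ y ≠ 0 then (1 : ℝ) else 0) ≤ 2 * d * (A.card : ℝ) := by
    have hbond : ∀ (y : Zd d) (μ : Fin d), (if fdiff μ φ y ≠ 0 then (1 : ℝ) else 0) ≤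
        (if y ∈ A then (1 : ℝ) else 0) + (if y + unitVec μ ∈ A then (1 : ℝ) else 0) := by
      intro y μ
      by_cases hf : fdiff μ φ y ≠ 0
      · rw [if_pos hf]
        have : φ y ≠ 0 ∨ φ (y + unitVec μ) ≠ 0 := by
          by_contra hboth
          push Not at hboth
          exact hf (by rw [fdiff_apply, hboth.1, hboth.2, sub_zero])
        rcases this with h | h
        · rw [if_pos (hφA _ h)]; split_ifs <;> norm_num
        · rw [if_pos (hφA _ h)]; split_ifs <;> norm_num
      · rw [if_neg hf]; split_ifs <;> norm_num
    have hcount1 : ∑ y ∈ box z (r + 1), (if y ∈ A then (1 : ℝ) else 0) ≤ A.card := by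
      rw [Finset.sum_boole]
      have : ((box z (r + 1)).filter fun y => y ∈ A).card ≤ A.card :=
        Finset.card_le_card fun y hy => (Finset.mem_filter.mp hy).2
      exact_mod_cast this
    have hcount2 : ∀ μ : Fin d, ∑ y ∈ box z (r + 1), (if y + unitVec μ ∈ A then (1 : ℝ) else 0) ≤ A.card := by
      intro μ
      rw [Finset.sum_boole]
      have : ((box z (r + 1)).filter fun y => y + unitVec μ ∈ A).card ≤ A.card :=
        Finset.card_le_card_of_injOn (fun y => y + unitVec μ)
          (fun y hy => (Finset.mem_filter.mp (Finset.mem_coe.mp hy)).2)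
          (fun y _ y' _ h => add_right_cancel h)
      exact_mod_cast this
    calc ∑ y ∈ box z (r + 1), ∑ μ : Fin d, (if fdiff μ φ y ≠ 0 then (1 : ℝ) else 0)
        ≤ ∑ y ∈ box z (r + 1), ∑ μ : Fin d, ((if y ∈ A then (1 : ℝ) else 0) + (if y + unitVec μ ∈ A then (1 : ℝ) else 0)) :=
          Finset.sum_le_sum fun y _ => Finset.sum_le_sum fun μ _ => hbond y μ
      _ = ∑ μ : Fin d, ((∑ y ∈ box z (r + 1), (if y ∈ A then (1 : ℝ) else 0)) +
            ∑ y ∈ box z (r + 1), (if y + unitVec μ ∈ A then (1 : ℝ) else 0)) := by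
          rw [Finset.sum_comm]
          exact Finset.sum_congr rfl fun μ _ => Finset.sum_add_distrib
      _ ≤ ∑ μ : Fin d, ((A.card : ℝ) + A.card) := Finset.sum_le_sum fun μ _ => add_le_add hcount1 (hcount2 μ)
      _ = 2 * d * (A.card : ℝ) := by
          rw [Finset.sum_const, Finset.card_univ, Fintype.card_fin, nsmul_eq_mul]; ring
  -- assemble: `E ≤ ½E + ½m²·(2d·#A)`
  have hE' : E ≤ (1 / 2) * E + (1 / 2) * m ^ 2 * (2 * d * (A.card : ℝ)) := by
    calc E ≤ ∑ y ∈ box z (r + 1), ∑ μ, fdiff μ φ y * g y μ := by rw [← h4, ← h3, ← h2]; exact h1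
      _ ≤ (1 / 2) * E + (1 / 2) * m ^ 2 * ∑ y ∈ box z (r + 1), ∑ μ : Fin d, (if fdiff μ φ y ≠ 0 then (1 : ℝ) else 0) := h5
      _ ≤ (1 / 2) * E + (1 / 2) * m ^ 2 * (2 * d * (A.card : ℝ)) := by
          have : 0 ≤ (1 / 2) * m ^ 2 := by positivity
          nlinarith [h6]
  nlinarith [hE']

/-! ## §3 One De Giorgi step through the Faber–Krahn inequality -/

/-- **ONE STEP**: under the hypotheses of `truncation_energy_le`, if the super-level set `{w > k}` (`k ≥ 0`) has `4·#{w > k} ≤ ρ^d` for a tile side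
`ρ ≥ 1`, then for every `h > k`: `(h−k)²·#{w > h} ≤ 8d²·m²·ρ²·#{w > k}` (`(h−k)²#{w>h} ≤ Σ_{w>k}(w−k)₊² ≤ 4dρ(ρ−1)·energy ≤ 4dρ²·2dm²#{w>k}`,
brick 2a `faberKrahn` + §2). [folklore] [cite: Giaquinta1984, Ch. III §2 p.78] -/
theorem deGiorgi_step {w : Zd d → ℝ} {z : Zd d} {r : ℤ} (g : Zd d → Fin d → ℝ) {m : ℝ}
    (hw0 : ∀ y ∉ box z r, w y = 0) (hw : ∀ y ∈ box z r, lop 0 w y = dvg g y)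
    (hg : ∀ y ∈ box z (r + 1), ∀ μ, |g y μ| ≤ m) {k h : ℝ} (hk : 0 ≤ k) (hkh : k < h) {ρ : ℕ} (hρ : 1 ≤ ρ)
    (hA : 4 * ((box z r).filter fun y => k < w y).card ≤ ρ ^ d) :
    (h - k) ^ 2 * (((box z r).filter fun y => h < w y).card : ℝ) ≤
      8 * (d : ℝ) ^ 2 * m ^ 2 * (ρ : ℝ) ^ 2 * (((box z r).filter fun y => k < w y).card : ℝ) := by
  classical
  set φ : Zd d → ℝ := fun x => max (w x - k) 0 with hφ
  set Ak := (box z r).filter fun y => k < w y with hAk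
  set Ah := (box z r).filter fun y => h < w y with hAh
  have hφ0 : ∀ y ∉ box z r, φ y = 0 := fun y hy => by
    simp only [hφ, hw0 y hy, zero_sub, max_eq_right (neg_nonpos.mpr hk)]
  have hS : ∀ x, φ x ≠ 0 → x ∈ Ak := by
    intro x hx
    have hxb : x ∈ box z r := by
      by_contra h0
      exact hx (hφ0 x h0)
    rw [hAk, Finset.mem_filter]
    refine ⟨hxb, ?_⟩
    by_contra hle
    push Not at hle
    exact hx (by simp only [hφ]; exact max_eq_right (by linarith))
  have hT : ∀ (x : Zd d) (i : Fin d), fdiff i φ x ≠ 0 → x ∈ box z (r + 1) := by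
    intro x i hx
    have : φ x ≠ 0 ∨ φ (x + unitVec i) ≠ 0 := by
      by_contra hboth
      push Not at hboth
      exact hx (by rw [fdiff_apply, hboth.1, hboth.2, sub_zero])
    rcases this with h0 | h0
    · exact box_mono z (by linarith) (Finset.mem_filter.mp (hS _ h0)).1
    · have hmem := (Finset.mem_filter.mp (hS _ h0)).1
      have := sub_unitVec_mem_box hmem i
      simpa using this
  -- Faber–Krahn + the truncation energy
  have hFK := faberKrahn (f := φ) hS hT hρ hA
  have hEn := truncation_energy_le g hk hw0 hw hg
  have hρ1 : (1 : ℝ) ≤ ρ := by exact_mod_cast hρ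
  have hcoef : 4 * ((d : ℝ) * ρ * ((ρ : ℝ) - 1)) ≤ 4 * (d : ℝ) * (ρ : ℝ) ^ 2 := by
    have : (0 : ℝ) ≤ d := Nat.cast_nonneg d
    nlinarith
  have hEn0 : 0 ≤ ∑ y ∈ box z (r + 1), ∑ μ, fdiff μ φ y ^ 2 := Finset.sum_nonneg fun _ _ => Finset.sum_nonneg fun _ _ => sq_nonneg _
  have hmass : ∑ x ∈ Ak, φ x ^ 2 ≤ 8 * (d : ℝ) ^ 2 * m ^ 2 * (ρ : ℝ) ^ 2 * (Ak.card : ℝ) := by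
    calc ∑ x ∈ Ak, φ x ^ 2 ≤ 4 * ((d : ℝ) * ρ * ((ρ : ℝ) - 1)) * ∑ x ∈ box z (r + 1), ∑ i : Fin d, fdiff i φ x ^ 2 := hFK
      _ ≤ 4 * (d : ℝ) * (ρ : ℝ) ^ 2 * ∑ x ∈ box z (r + 1), ∑ i : Fin d, fdiff i φ x ^ 2 := mul_le_mul_of_nonneg_right hcoef hEn0
      _ ≤ 4 * (d : ℝ) * (ρ : ℝ) ^ 2 * (2 * d * m ^ 2 * (Ak.card : ℝ)) := mul_le_mul_of_nonneg_left hEn (by positivity)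
      _ = 8 * (d : ℝ) ^ 2 * m ^ 2 * (ρ : ℝ) ^ 2 * (Ak.card : ℝ) := by ring
  -- on `{w > h}` the truncation is at least `h − k`
  have hsub : Ah ⊆ Ak := by
    intro y hy
    rw [hAh, Finset.mem_filter] at hy
    rw [hAk, Finset.mem_filter]
    exact ⟨hy.1, lt_trans hkh hy.2⟩
  have hlow : (h - k) ^ 2 * (Ah.card : ℝ) ≤ ∑ x ∈ Ak, φ x ^ 2 := by
    calc (h - k) ^ 2 * (Ah.card : ℝ) = ∑ x ∈ Ah, (h - k) ^ 2 := by rw [Finset.sum_const, nsmul_eq_mul]; ring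
      _ ≤ ∑ x ∈ Ah, φ x ^ 2 := by
          refine Finset.sum_le_sum fun x hx => ?_
          rw [hAh, Finset.mem_filter] at hx
          have hle : h - k ≤ φ x := by
            simp only [hφ]
            exact le_trans (by linarith [hx.2]) (le_max_left _ _)
          exact pow_le_pow_left₀ (by linarith) hle 2
      _ ≤ ∑ x ∈ Ak, φ x ^ 2 := Finset.sum_le_sum_of_subset_of_nonneg hsub fun _ _ _ => sq_nonneg _
  exact hlow.trans hmass

/-! ## §4 The sup bound for the Dirichlet corrector -/

/-- One-sided form: `w ≤ 64·2^d·d·m·(2r+1)` on `ℤ^d`. [folklore] [cite: Giaquinta1984, Ch. III §2 p.78] -/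
theorem le_of_dirichlet (hd : 1 ≤ d) {w : Zd d → ℝ} {z : Zd d} {r : ℤ} (hr : 0 ≤ r) (g : Zd d → Fin d → ℝ) {m : ℝ} (hm : 0 ≤ m)
    (hw0 : ∀ y ∉ box z r, w y = 0) (hw : ∀ y ∈ box z r, lop 0 w y = dvg g y)
    (hg : ∀ y ∈ box z (r + 1), ∀ μ, |g y μ| ≤ m) (y : Zd d) :
    w y ≤ 64 * (2 : ℝ) ^ d * d * m * (2 * (r : ℝ) + 1) := by
  classical
  -- the counting function of super-level sets
  set A : ℝ → ℕ := fun k => ((box z r).filter fun x => k < w x).card with hA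
  have hmono : ∀ k h : ℝ, k ≤ h → A h ≤ A k := fun k h hkh =>
    Finset.card_le_card fun x hx => by
      rw [Finset.mem_filter] at hx ⊢
      exact ⟨hx.1, lt_of_le_of_lt hkh hx.2⟩
  set M : ℕ := (2 * r + 1).toNat with hM
  have hMR : ((M : ℕ) : ℝ) = 2 * (r : ℝ) + 1 := by
    have : ((M : ℕ) : ℤ) = 2 * r + 1 := by rw [hM]; exact Int.toNat_of_nonneg (by linarith)
    exact_mod_cast this
  have hM1 : 1 ≤ M := by rw [hM]; omega
  have hA0 : A 0 ≤ M ^ d := by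
    have h1 : A 0 ≤ (box z r).card := Finset.card_filter_le _ _
    have h2 : ((box z r).card : ℝ) = ((2 * r + 1 : ℤ) : ℝ) ^ d := card_box z hr
    have h3 : ((box z r).card : ℝ) = ((M ^ d : ℕ) : ℝ) := by rw [h2]; push_cast; rw [hMR]
    have h4 : (box z r).card = M ^ d := by exact_mod_cast h3
    omega
  have hstep : ∀ (k h : ℝ) (ρ : ℕ), 0 ≤ k → k < h → 1 ≤ ρ → 4 * A k ≤ ρ ^ d →
      (h - k) ^ 2 * (A h : ℝ) ≤ (8 * (d : ℝ) ^ 2 * m ^ 2) * (ρ : ℝ) ^ 2 * (A k : ℝ) := by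
    intro k h ρ hk hkh hρ hAk
    have := deGiorgi_step g hw0 hw hg hk hkh hρ hAk
    simp only [hA]
    linarith
  have hC : 0 ≤ 8 * (d : ℝ) ^ 2 * m ^ 2 := by positivity
  -- every `D > 0` with `D² ≥ 256·2^d·C·M²` is a bound
  have hbound : ∀ D : ℝ, 0 < D → 256 * (2 : ℝ) ^ d * (8 * (d : ℝ) ^ 2 * m ^ 2) * (M : ℝ) ^ 2 ≤ D ^ 2 → w y ≤ D := by
    intro D hD hD2
    have hAD := levels_vanish hd A hmono hM1 hA0 hC hstep hD hD2
    by_cases hy : y ∈ box z r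
    · by_contra hlt
      push Not at hlt
      have : y ∈ (box z r).filter fun x => D < w x := Finset.mem_filter.mpr ⟨hy, hlt⟩
      have : 0 < A D := Finset.card_pos.mpr ⟨y, this⟩
      omega
    · rw [hw0 y hy]; exact hD.le
  set D₀ : ℝ := 64 * (2 : ℝ) ^ d * d * m * (2 * (r : ℝ) + 1) with hD₀
  have hd1 : (1 : ℝ) ≤ d := by exact_mod_cast hd
  have hr0 : (0 : ℝ) ≤ r := by exact_mod_cast hr
  have hr1 : (1 : ℝ) ≤ 2 * (r : ℝ) + 1 := by linarith
  have hsq : 256 * (2 : ℝ) ^ d * (8 * (d : ℝ) ^ 2 * m ^ 2) * (M : ℝ) ^ 2 ≤ D₀ ^ 2 := by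
    rw [hMR, hD₀]
    have h2d : (2 : ℝ) ^ d ≤ ((2 : ℝ) ^ d) ^ 2 := by
      have : (1 : ℝ) ≤ (2 : ℝ) ^ d := one_le_pow₀ (by norm_num)
      nlinarith
    have : 0 ≤ (d : ℝ) ^ 2 * m ^ 2 * (2 * (r : ℝ) + 1) ^ 2 := by positivity
    nlinarith
  rcases eq_or_lt_of_le hm with hm0 | hmpos
  · -- `m = 0`: every positive level is empty
    have hall : ∀ D : ℝ, 0 < D → w y ≤ D := fun D hD => hbound D hD (by rw [← hm0]; ring_nf; positivity)
    have hle0 : w y ≤ 0 := le_of_forall_pos_le_add fun ε hε => by have := hall ε hε; linarith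
    have hD00 : D₀ = 0 := by rw [hD₀, ← hm0]; ring
    rw [hD00]; exact hle0
  · have hD₀pos : 0 < D₀ := by rw [hD₀]; positivity
    exact hbound D₀ hD₀pos hsq

/-- ★★ **THE `L^∞` BOUND FOR THE BOX DIRICHLET CORRECTOR WITH DIVERGENCE-FORM DATA.**  `d ≥ 1`, `r ≥ 0`, `m ≥ 0`; if `w = 0` off `Q_r(z)`,
`−Δw = ∂*g` on `Q_r(z)` and `|g(y,μ)| ≤ m` for `y ∈ Q_{r+1}(z)`, then `|w(y)| ≤ 64·2^d·d·m·(2r+1)` for every `y ∈ ℤ^d` — the optimal scaling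
`r·‖g‖_∞` (De Giorgi ∕ Stampacchia via `levels_vanish`, applied to `w` and `−w`). [folklore] [cite: Giaquinta1984, Ch. III §2 p.78; Balaban1984PropagatorsII, (1.9) p.226] -/
theorem abs_le_of_dirichlet (hd : 1 ≤ d) {w : Zd d → ℝ} {z : Zd d} {r : ℤ} (hr : 0 ≤ r) (g : Zd d → Fin d → ℝ) {m : ℝ} (hm : 0 ≤ m)
    (hw0 : ∀ y ∉ box z r, w y = 0) (hw : ∀ y ∈ box z r, lop 0 w y = dvg g y)
    (hg : ∀ y ∈ box z (r + 1), ∀ μ, |g y μ| ≤ m) (y : Zd d) :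
    |w y| ≤ 64 * (2 : ℝ) ^ d * d * m * (2 * (r : ℝ) + 1) := by
  rw [abs_le]
  refine ⟨?_, le_of_dirichlet hd hr g hm hw0 hw hg y⟩
  -- apply the one-sided bound to `−w`, `−g`
  have h := le_of_dirichlet hd hr (fun x μ => (-1) * g x μ) (m := m) hm (w := fun x => (-1) * w x)
    (fun x hx => by rw [hw0 x hx, mul_zero]) (fun x hx => by rw [lop_const_mul, dvg_const_mul, hw x hx])
    (fun x hx μ => by rw [neg_one_mul, abs_neg]; exact hg x hx μ) y
  linarith

end Summit.QuantumFields.YangMills.Theorems.Prop7FlatDirichletSup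

end
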